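import Mathlib.MeasureTheory.Measure.Lebesgue.EqHaar
import Mathlib.Analysis.Calculus.FDeriv.Add
import Mathlib.Analysis.Calculus.ContDiff.Basic
import Literature.Geometry.Lorentzian.HorizonPenetratingTeukolsky
import Literature.Geometry.Lorentzian.KerrSchildHomogeneity
import HarnessLib

/-!
# The weighted Teukolsky energies are dilation comparable

Stub `D3` (`stub_teukolskyEnergyOn_dilate`) of the line `bounded-kappa-closing-box` for the crux
`BulkKerrCaptureC2` (route `PhaseMixingCapture`): for `λ ∈ [lo, hi] ⊂ (0, ∞)` the weighted
`k`-th order energies `Kerr.teukolskyEnergyOn` of `α` (chart `{r > λr₀}` of Kerr(`λM, λa`), leaf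
`t* = λτ`, set `λ • A`) and of `α ∘ D_λ` (chart `{r > r₀}` of Kerr(`M, a`), leaf `t* = τ`, set
`A`) bound each other up to a constant `K(s, k, p, lo, hi)`; no regularity of `α` is assumed.

Proof. (i) The rescaled tensorised fields satisfy `T_dil(λz) = c T(z)` at every point (junk
values included), `c = (λ²)^s (λ²)^{-max(s,0)} λ²`, hence so do their extensions by zero on `ℝ⁴`.
(ii) For ANY function, `‖D^m[F(b·)](x)‖ ≤ |b|^m ‖D^m F(bx)‖` and `D^m(cF) = c D^m F` over `ℝ`,
so `‖D^m T_dil‾(λz)‖ ≤ |c| λ^{-m} ‖D^m T‾(z)‖`. (iii) Lebesgue measure on `ℝ³` scales by `λ³`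
under `x ↦ λx` (a measurable equivalence: no measurability of `A` needed), `(λτ, λy) = λ(τ, y)`,
and `(1 + ‖λy‖)^p ≤ D^{|p|}(1 + ‖y‖)^p` for `λ, λ⁻¹ ≤ D`. (iv) With `D = max 1 hi lo⁻¹` every
factor is a power of `D`; the converse inequality is the same estimate for `λ⁻¹`, `c⁻¹`.

## References

* M. Dafermos, G. Holzegel, I. Rodnianski, M. Taylor, arXiv:2212.14093, §1.1 (1.3)
  (key `DafermosHolzegelRodnianskiTaylor2022`).
* M. Dafermos, I. Rodnianski, arXiv:0811.0354, §4 (key `arXiv08110354`).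
-/

-- the doubled `FinalStateConjecture.FinalStateConjecture` path component trips dupNamespace
set_option linter.dupNamespace false

noncomputable section

namespace Summit.FinalStateConjecture.FinalStateConjecture.Theorems.BulkKerrCaptureC2.TeukolskyEnergyDilate

open Literature.Geometry.Lorentzian MeasureTheory Set
open scoped Manifold ContDiff Topology Pointwise ENNReal

variable {E F G : Type*} [NormedAddCommGroup E] [NormedSpace ℝ E] [NormedAddCommGroup F]
  [NormedSpace ℝ F] [NormedAddCommGroup G] [NormedSpace ℝ G] {lam : ℝ}

/-! ### Iterated derivatives under dilations and constant multiples (no differentiability) -/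

/-- **Constants come out of iterated derivatives** over `ℝ`, without any differentiability
hypothesis: `D^m (r • g) = r • D^m g` (`fderiv_const_smul_field`, iterated). [folklore] -/
private theorem iteratedFDeriv_const_smul_real (g : E → F) (r : ℝ) (m : ℕ) :
    iteratedFDeriv ℝ m (fun y ↦ r • g y) = fun y ↦ r • iteratedFDeriv ℝ m g y := by
  induction m with
  | zero =>
    ext y v
    simp
  | succ m ih =>
    funext y
    have hf := fderiv_const_smul_field (𝕜 := ℝ) (R := ℝ) (f := iteratedFDeriv ℝ m g) r
    rw [iteratedFDeriv_succ_eq_comp_left, iteratedFDeriv_succ_eq_comp_left, Function.comp_apply,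
      Function.comp_apply, ih, ← Pi.smul_def, hf, Pi.smul_apply, LinearIsometryEquiv.map_smul]

/-- **Chain rule for a homothety, in norm**: `‖D^m [ψ(b ·)](x)‖ ≤ |b|^m ‖D^m ψ (bx)‖` for
`b ≠ 0`, without differentiability (composition with a linear equivalence). [folklore] -/
private theorem norm_iteratedFDeriv_comp_smul_le (ψ : E → F) {b : ℝ} (hb : b ≠ 0) (m : ℕ)
    (x : E) :
    ‖iteratedFDeriv ℝ m (fun y ↦ ψ (b • y)) x‖ ≤ |b| ^ m * ‖iteratedFDeriv ℝ m ψ (b • x)‖ := by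
  set e : E ≃L[ℝ] E := ContinuousLinearEquiv.equivOfInverse (b • ContinuousLinearMap.id ℝ E)
    (b⁻¹ • ContinuousLinearMap.id ℝ E) (fun y ↦ by simp [smul_smul, hb])
    (fun y ↦ by simp [smul_smul, hb])
  have hee : ∀ y, e y = b • y := fun y ↦ rfl
  have hcomp : (fun y ↦ ψ (b • y)) = ψ ∘ e := rfl
  have h := e.iteratedFDerivWithin_comp_right ψ uniqueDiffOn_univ (mem_univ (e x)) m
  simp only [preimage_univ, iteratedFDerivWithin_univ] at h
  rw [hcomp, h, hee x, mul_comm]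
  refine (ContinuousMultilinearMap.norm_compContinuousLinearMap_le _ _).trans ?_
  rw [Finset.prod_const, Finset.card_univ, Fintype.card_fin]
  refine mul_le_mul_of_nonneg_left (pow_le_pow_left₀ (norm_nonneg _) ?_ m) (norm_nonneg _)
  refine ContinuousLinearMap.opNorm_le_bound _ (abs_nonneg b) fun y ↦ ?_
  rw [ContinuousLinearEquiv.coe_coe, hee y, norm_smul, Real.norm_eq_abs]

/-- **Iterated derivatives of a dilate**: if `Φ'(λz) = c • Φ(z)` for all `z` (`λ > 0`), then
`‖D^m Φ'(λz)‖² ≤ D^{2N + 2k} ‖D^m Φ(z)‖²` for `m ≤ k`, `|c| ≤ D^N`, `λ⁻¹ ≤ D`, `D ≥ 1`.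
[folklore] -/
private theorem norm_iteratedFDeriv_dilate_sq_le {D c : ℝ} {N k m : ℕ} (hD : 1 ≤ D)
    (hlam : 0 < lam) (hlamD' : lam⁻¹ ≤ D) (hc : |c| ≤ D ^ N) {Φ Φ' : E → F}
    (hΦ : ∀ z : E, Φ' (lam • z) = c • Φ z) (hm : m ≤ k) (z : E) :
    ‖iteratedFDeriv ℝ m Φ' (lam • z)‖ ^ 2 ≤ D ^ (2 * N + 2 * k) * ‖iteratedFDeriv ℝ m Φ z‖ ^ 2 := by
  have hne : lam ≠ 0 := hlam.ne'
  have hΦ' : Φ' = fun w ↦ c • (fun w ↦ Φ (lam⁻¹ • w)) w :=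
    funext fun w ↦ by rw [← hΦ (lam⁻¹ • w), smul_inv_smul₀ hne]
  have h2 := norm_iteratedFDeriv_comp_smul_le Φ (inv_ne_zero hne) m (lam • z)
  rw [inv_smul_smul₀ hne, abs_of_pos (inv_pos.2 hlam)] at h2
  have h3 : ‖iteratedFDeriv ℝ m Φ' (lam • z)‖ ≤ D ^ (N + k) * ‖iteratedFDeriv ℝ m Φ z‖ := by
    rw [hΦ', iteratedFDeriv_const_smul_real, norm_smul, Real.norm_eq_abs, pow_add, mul_assoc]
    refine mul_le_mul hc (h2.trans (mul_le_mul_of_nonneg_right ?_ (norm_nonneg _)))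
      (norm_nonneg _) (pow_nonneg (zero_le_one.trans hD) N)
    exact (pow_le_pow_left₀ (inv_nonneg.2 hlam.le) hlamD' m).trans (pow_le_pow_right₀ hD hm)
  calc ‖iteratedFDeriv ℝ m Φ' (lam • z)‖ ^ 2 ≤ (D ^ (N + k) * ‖iteratedFDeriv ℝ m Φ z‖) ^ 2 :=
        pow_le_pow_left₀ (norm_nonneg _) h3 2
    _ = D ^ (2 * N + 2 * k) * ‖iteratedFDeriv ℝ m Φ z‖ ^ 2 := by ring

/-! ### Weights, scaling constants and the change of variables on `ℝ³` -/

/-- **The weights under dilation**: `(1 + ‖λx‖)^p ≤ D^{|p|} (1 + ‖x‖)^p` for `λ, λ⁻¹ ≤ D`,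
`D ≥ 1` (since `D⁻¹ (1 + ‖x‖) ≤ 1 + λ‖x‖ ≤ D (1 + ‖x‖)`; cases on the sign of `p`). [folklore] -/
private theorem weight_dilate_le {D : ℝ} (hlam : 0 < lam) (hD : 1 ≤ D) (hlamD : lam ≤ D)
    (hlamD' : lam⁻¹ ≤ D) (p : ℝ) (x : E3) :
    (1 + ‖lam • x‖) ^ p ≤ D ^ |p| * (1 + ‖x‖) ^ p := by
  have hu : 0 < 1 + ‖x‖ := by positivity
  have hD0 : 0 < D := one_pos.trans_le hD
  have hn : ‖lam • x‖ = lam * ‖x‖ := by rw [norm_smul, Real.norm_eq_abs, abs_of_pos hlam]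
  rcases le_or_gt 0 p with hp | hp
  · have h1 : 1 + ‖lam • x‖ ≤ D * (1 + ‖x‖) := by
      rw [hn]
      nlinarith [mul_le_mul_of_nonneg_right hlamD (norm_nonneg x)]
    rw [abs_of_nonneg hp, ← Real.mul_rpow hD0.le hu.le]
    exact Real.rpow_le_rpow (by positivity) h1 hp
  · have h2 : D⁻¹ * (1 + ‖x‖) ≤ 1 + ‖lam • x‖ := by
      rw [hn, inv_mul_le_iff₀ hD0]
      nlinarith [mul_le_mul_of_nonneg_right ((inv_le_iff_one_le_mul₀ hlam).1 hlamD')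
        (norm_nonneg x)]
    rw [abs_of_neg hp, Real.rpow_neg hD0.le, ← Real.inv_rpow hD0.le,
      ← Real.mul_rpow (inv_nonneg.2 hD0.le) hu.le]
    exact Real.rpow_le_rpow_of_nonpos (by positivity) h2 hp.le

/-- Integer powers on a compact range: `t ^ n ≤ D ^ |n|` for `0 < t ≤ D`, `t⁻¹ ≤ D`. [folklore] -/
private theorem zpow_le_pow_natAbs {t D : ℝ} (ht : 0 < t) (htD : t ≤ D) (htD' : t⁻¹ ≤ D)
    (n : ℤ) : t ^ n ≤ D ^ n.natAbs := by
  obtain ⟨m, rfl | rfl⟩ := Int.eq_nat_or_neg n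
  · rw [zpow_natCast, Int.natAbs_natCast]
    exact pow_le_pow_left₀ ht.le htD m
  · rw [zpow_neg, zpow_natCast, Int.natAbs_neg, Int.natAbs_natCast, ← inv_pow]
    exact pow_le_pow_left₀ (inv_nonneg.2 ht.le) htD' m

/-- **The scaling constant is bounded on compact ranges**: `t^s t^{-max(s,0)} t ≤ D^{4|s| + 2}`
for `0 < t ≤ D²`, `t⁻¹ ≤ D²`, `D ≥ 1` (applied with `t = λ²` and `t = λ⁻²`). [folklore] -/
private theorem scaleConst_le {t D : ℝ} (s : ℤ) (ht : 0 < t) (hD : 1 ≤ D) (htD : t ≤ D ^ 2)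
    (htD' : t⁻¹ ≤ D ^ 2) : t ^ s * t ^ (-max s 0) * t ≤ D ^ (4 * s.natAbs + 2) := by
  have hD2 : 1 ≤ D ^ 2 := one_le_pow₀ hD
  have h1 : t ^ s ≤ (D ^ 2) ^ s.natAbs := zpow_le_pow_natAbs ht htD htD' s
  have h2 : t ^ (-max s 0) ≤ (D ^ 2) ^ s.natAbs := by
    refine (zpow_le_pow_natAbs ht htD htD' _).trans (pow_le_pow_right₀ hD2 ?_)
    omega
  calc t ^ s * t ^ (-max s 0) * t ≤ (D ^ 2) ^ s.natAbs * (D ^ 2) ^ s.natAbs * D ^ 2 :=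
        mul_le_mul (mul_le_mul h1 h2 (zpow_nonneg ht.le _) (by positivity)) htD ht.le
          (by positivity)
    _ = D ^ (4 * s.natAbs + 2) := by ring

/-- **Change of variables `y = λx` in a set `lintegral` over `ℝ³`**:
`∫⁻_{y ∈ λ • A} G(y) dy = λ³ ∫⁻_{x ∈ A} G(λx) dx` for `λ > 0`, ANY `G` and ANY set `A`
(`Measure.map_addHaar_smul` through the measurable equivalence `x ↦ λx`). [folklore] -/
private theorem setLIntegral_dilate (hlam : 0 < lam) (G : E3 → ℝ≥0∞) (A : Set E3) :
    ∫⁻ y in lam • A, G y = ENNReal.ofReal (lam ^ 3) * ∫⁻ x in A, G (lam • x) := by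
  have hne : lam ≠ 0 := hlam.ne'
  have h3 : 0 < lam ^ 3 := pow_pos hlam 3
  set e : E3 ≃ᵐ E3 := (Homeomorph.smul (Units.mk0 lam hne)).toMeasurableEquiv
  have he : (e : E3 → E3) = fun x ↦ lam • x := rfl
  have hpre : e ⁻¹' (lam • A) = A := Set.ext fun x ↦ Set.smul_mem_smul_set_iff₀ hne A x
  have hmap : Measure.map (e : E3 → E3) volume =
      ENNReal.ofReal |(lam ^ 3)⁻¹| • (volume : Measure E3) := by
    rw [he, Measure.map_addHaar_smul volume hne, finrank_euclideanSpace_fin]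
  have h : ∫⁻ x in A, G (lam • x) = ENNReal.ofReal ((lam ^ 3)⁻¹) * ∫⁻ y in lam • A, G y := by
    calc ∫⁻ x in A, G (lam • x) = ∫⁻ x in e ⁻¹' (lam • A), G (e x) := by rw [hpre, he]
      _ = ∫⁻ y, G y ∂((volume.restrict (e ⁻¹' (lam • A))).map e) := (lintegral_map_equiv G e).symm
      _ = ENNReal.ofReal ((lam ^ 3)⁻¹) * ∫⁻ y in lam • A, G y := by
          rw [← MeasurableEquiv.restrict_map, hmap, Measure.restrict_smul, lintegral_smul_measure,
            smul_eq_mul, abs_of_pos (inv_pos.2 h3)]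
  rw [h, ← mul_assoc, ← ENNReal.ofReal_mul h3.le, mul_inv_cancel₀ h3.ne', ENNReal.ofReal_one,
    one_mul]

/-! ### The comparison of weighted slice energies under a dilation -/

/-- **Pointwise comparison of the energy integrands**: if `Φ'(λz) = c • Φ(z)` on `ℝ⁴` and
`λz ∈ U' ↔ z ∈ U`, the integrand of the weighted `k`-th order energy of `Φ'` at `λx` on the leaf
`{t* = λτ}` is at most `D^{2N + 2k} D^{|p|}` times that of `Φ` at `x` on `{t* = τ}`. [folklore] -/
private theorem integrand_dilate_le {D c : ℝ} {N : ℕ} (k : ℕ) (p : ℝ) (hD : 1 ≤ D)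
    (hlam : 0 < lam) (hlamD : lam ≤ D) (hlamD' : lam⁻¹ ≤ D) (hc : |c| ≤ D ^ N)
    {U U' : TopologicalSpace.Opens E4} (hUU' : ∀ z : E4, lam • z ∈ U' ↔ z ∈ U) {Φ Φ' : E4 → G}
    (hΦ : ∀ z : E4, Φ' (lam • z) = c • Φ z) (τ : ℝ) (x : E3) :
    {y : E3 | E4.ofTimeSpace (lam * τ) y ∈ U'}.indicator
        (fun y ↦ ENNReal.ofReal ((1 + ‖y‖) ^ p * ∑ m ∈ Finset.range (k + 1),
          ‖iteratedFDeriv ℝ m Φ' (E4.ofTimeSpace (lam * τ) y)‖ ^ 2)) (lam • x) ≤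
      ENNReal.ofReal (D ^ (2 * N + 2 * k) * D ^ |p|) *
        {y : E3 | E4.ofTimeSpace τ y ∈ U}.indicator
          (fun y ↦ ENNReal.ofReal ((1 + ‖y‖) ^ p * ∑ m ∈ Finset.range (k + 1),
            ‖iteratedFDeriv ℝ m Φ (E4.ofTimeSpace τ y)‖ ^ 2)) x := by
  have hD0 : 0 ≤ D := zero_le_one.trans hD
  have hpt : E4.ofTimeSpace (lam * τ) (lam • x) = lam • E4.ofTimeSpace τ x :=
    (Kerr.smul_ofTimeSpace lam τ x).symm
  have hmem : lam • x ∈ {y : E3 | E4.ofTimeSpace (lam * τ) y ∈ U'} ↔ E4.ofTimeSpace τ x ∈ U := by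
    rw [mem_setOf_eq, hpt, hUU']
  by_cases hx : E4.ofTimeSpace τ x ∈ U
  · rw [indicator_of_mem (hmem.2 hx),
      indicator_of_mem (show x ∈ {y : E3 | E4.ofTimeSpace τ y ∈ U} from hx),
      ← ENNReal.ofReal_mul (by positivity), hpt]
    refine ENNReal.ofReal_le_ofReal ?_
    calc _ ≤ (D ^ |p| * (1 + ‖x‖) ^ p) * ∑ m ∈ Finset.range (k + 1),
          D ^ (2 * N + 2 * k) * ‖iteratedFDeriv ℝ m Φ (E4.ofTimeSpace τ x)‖ ^ 2 :=
        mul_le_mul (weight_dilate_le hlam hD hlamD hlamD' p x)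
          (Finset.sum_le_sum fun m hm ↦ norm_iteratedFDeriv_dilate_sq_le hD hlam hlamD' hc hΦ
            (Nat.lt_succ_iff.1 (Finset.mem_range.1 hm)) _)
          (Finset.sum_nonneg fun m _ ↦ sq_nonneg _) (by positivity)
      _ = _ := by
        rw [← Finset.mul_sum]
        ring
  · rw [indicator_of_notMem (mt hmem.1 hx)]
    exact bot_le

/-- **The one-sided comparison**: if the extensions by zero of `f' : U' → G` and `f : U → G`
satisfy `f'‾(λz) = c • f‾(z)` on `ℝ⁴` and `λz ∈ U' ↔ z ∈ U` (`λ, λ⁻¹ ≤ D`, `|c| ≤ D^N`,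
`D ≥ 1`), the energy of `f'` through `{t* = λτ} ∩ {y ∈ λ • A}` is at most
`D^{2N + 2k + 3} D^{|p|}` times that of `f` through `{t* = τ} ∩ {y ∈ A}`. [folklore] -/
private theorem sliceSobolevEnergy_dilate_le {D c : ℝ} {N : ℕ} (k : ℕ) (p : ℝ) (hD : 1 ≤ D)
    (hlam : 0 < lam) (hlamD : lam ≤ D) (hlamD' : lam⁻¹ ≤ D) (hc : |c| ≤ D ^ N)
    {U U' : TopologicalSpace.Opens E4} (hUU' : ∀ z : E4, lam • z ∈ U' ↔ z ∈ U) {f : U → G}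
    {f' : U' → G}
    (hff' : ∀ z : E4, Function.extend Subtype.val f' (0 : E4 → G) (lam • z) =
      c • Function.extend Subtype.val f (0 : E4 → G) z)
    (τ : ℝ) (A : Set E3) :
    sliceSobolevEnergy U' f' (lam * τ) k p (lam • A) ≤
      ENNReal.ofReal (D ^ (2 * N + 2 * k + 3) * D ^ |p|) * sliceSobolevEnergy U f τ k p A := by
  unfold sliceSobolevEnergy
  refine (setLIntegral_dilate hlam _ A).trans_le ?_
  refine (mul_le_mul' (ENNReal.ofReal_le_ofReal (pow_le_pow_left₀ hlam.le hlamD 3))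
    (lintegral_mono fun x ↦ integrand_dilate_le k p hD hlam hlamD hlamD' hc hUU' hff' τ x)).trans
    (le_of_eq ?_)
  rw [lintegral_const_mul' _ _ ENNReal.ofReal_ne_top, ← mul_assoc,
    ← ENNReal.ofReal_mul (pow_nonneg (zero_le_one.trans hD) 3)]
  congr 2
  ring

/-- **The two-sided comparison**: if moreover `c ≠ 0` and `|c⁻¹| ≤ D^N`, the two energies
bound EACH OTHER by `D^{2N + 2k + 3} D^{|p|}` (the one-sided estimate for `λ⁻¹`, `c⁻¹`, read at
the leaf `λτ` and the set `λ • A`). [folklore] -/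
private theorem sliceSobolevEnergy_dilate_le_le {D c : ℝ} {N : ℕ} (k : ℕ) (p : ℝ) (hD : 1 ≤ D)
    (hlam : 0 < lam) (hlamD : lam ≤ D) (hlamD' : lam⁻¹ ≤ D) (hc0 : c ≠ 0) (hc : |c| ≤ D ^ N)
    (hc' : |c⁻¹| ≤ D ^ N) {U U' : TopologicalSpace.Opens E4}
    (hUU' : ∀ z : E4, lam • z ∈ U' ↔ z ∈ U) {f : U → G} {f' : U' → G}
    (hff' : ∀ z : E4, Function.extend Subtype.val f' (0 : E4 → G) (lam • z) =
      c • Function.extend Subtype.val f (0 : E4 → G) z)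
    (τ : ℝ) (A : Set E3) :
    sliceSobolevEnergy U' f' (lam * τ) k p (lam • A) ≤
        ENNReal.ofReal (D ^ (2 * N + 2 * k + 3) * D ^ |p|) * sliceSobolevEnergy U f τ k p A ∧
      sliceSobolevEnergy U f τ k p A ≤
        ENNReal.ofReal (D ^ (2 * N + 2 * k + 3) * D ^ |p|) *
          sliceSobolevEnergy U' f' (lam * τ) k p (lam • A) := by
  have hne : lam ≠ 0 := hlam.ne'
  refine ⟨sliceSobolevEnergy_dilate_le k p hD hlam hlamD hlamD' hc hUU' hff' τ A, ?_⟩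
  have hUU'2 : ∀ z : E4, lam⁻¹ • z ∈ U ↔ z ∈ U' := fun z ↦ by
    rw [← hUU' (lam⁻¹ • z), smul_inv_smul₀ hne]
  have hff'2 : ∀ z : E4, Function.extend Subtype.val f (0 : E4 → G) (lam⁻¹ • z) =
      c⁻¹ • Function.extend Subtype.val f' (0 : E4 → G) z := fun z ↦ by
    rw [eq_inv_smul_iff₀ hc0, ← hff' (lam⁻¹ • z), smul_inv_smul₀ hne]
  have h := sliceSobolevEnergy_dilate_le k p hD (inv_pos.2 hlam) hlamD' (by rwa [inv_inv]) hc'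
    hUU'2 hff'2 (lam * τ) (lam • A)
  rwa [inv_mul_cancel_left₀ hne, inv_smul_smul₀ hne] at h

/-! ### Dilation of the rescaled tensorised field (pointwise, junk values included) -/

/-- **The spin frame scales by `λ`**: `m_s(λa; λx) = λ m_s(a; x)` componentwise (`λ > 0`; the
components of `m` are `cot θ xᵢ`, `xᵢ / sin θ`, `−r sin θ` with `r(λa; λx) = λ r(a; x)` and
`cos θ`, `sin θ` invariant; junk values on the axis included; `λ` is real). [folklore] -/
private theorem spinFrame_dilate (hlam : 0 < lam) (a : ℝ) (s : ℤ) (x : E4) (μ : Fin 4) :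
    Kerr.spinFrame (lam * a) s (lam • x) μ = (lam : ℂ) * Kerr.spinFrame a s x μ := by
  have hr := Kerr.radius_smul hlam a x
  have hx : ∀ i, (lam • x) i = lam * x i := fun i ↦ by simp
  have hϖ : Kerr.axialRadius (lam • x) = lam * Kerr.axialRadius x := by
    unfold Kerr.axialRadius
    rw [hx, hx, show (lam * x 1) ^ 2 + (lam * x 2) ^ 2 = lam ^ 2 * (x 1 ^ 2 + x 2 ^ 2) by ring,
      Real.sqrt_mul (sq_nonneg lam), Real.sqrt_sq hlam.le]
  have hc : Kerr.cosTheta (lam * a) (lam • x) = Kerr.cosTheta a x := by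
    unfold Kerr.cosTheta
    rw [hr, hx]
    exact mul_div_mul_left _ _ hlam.ne'
  have hs : Kerr.sinTheta (lam * a) (lam • x) = Kerr.sinTheta a x := by
    unfold Kerr.sinTheta
    rw [hϖ, hr, show (lam * Kerr.radius a x) ^ 2 + (lam * a) ^ 2 =
        lam ^ 2 * (Kerr.radius a x ^ 2 + a ^ 2) by ring,
      Real.sqrt_mul (sq_nonneg lam), Real.sqrt_sq hlam.le]
    exact mul_div_mul_left _ _ hlam.ne'
  have hm : ∀ μ : Fin 4, Kerr.frameM (lam * a) (lam • x) μ = (lam : ℂ) * Kerr.frameM a x μ :=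
    fun μ ↦ by fin_cases μ <;> simp [Kerr.frameM, hc, hs, hr] <;> ring
  unfold Kerr.spinFrame
  split_ifs
  · rw [Pi.star_apply, Pi.star_apply, hm, star_mul']
    congr 1
    exact Complex.conj_ofReal lam
  · exact hm μ

/-- **The horizon-regular rescaling factor scales** by `(λ²)^s (λ²)^{-max(s,0)}` under
`(M, a, x) ↦ (λM, λa, λx)` (`λ > 0`; `Δ(λM, λa; λr) = λ² Δ(M, a; r)`; an identity of
junk-extended integer powers, valid also where `Δ = 0`). [folklore] -/
private theorem rescaleFactor_dilate (hlam : 0 < lam) (M a : ℝ) (s : ℤ) (x : E4) :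
    Kerr.delta (lam * M) (lam * a) (Kerr.radius (lam * a) (lam • x)) ^ s *
        (Kerr.radius (lam * a) (lam • x) ^ 2 + (lam * a) ^ 2) ^ (-max s 0) =
      (lam ^ 2) ^ s * (lam ^ 2) ^ (-max s 0) *
        (Kerr.delta M a (Kerr.radius a x) ^ s * (Kerr.radius a x ^ 2 + a ^ 2) ^ (-max s 0)) := by
  rw [Kerr.radius_smul hlam,
    show Kerr.delta (lam * M) (lam * a) (lam * Kerr.radius a x) =
      lam ^ 2 * Kerr.delta M a (Kerr.radius a x) by unfold Kerr.delta; ring,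
    show (lam * Kerr.radius a x) ^ 2 + (lam * a) ^ 2 = lam ^ 2 * (Kerr.radius a x ^ 2 + a ^ 2)
      by ring,
    mul_zpow, mul_zpow]
  ring

/-- **The extensions by zero of the rescaled tensorised fields under the dilation**: for `α` on
the chart `{r > λr₀}` of Kerr(`λM, λa`) and every `z ∈ ℝ⁴`,
`(α̃ m_s ⊗ m_s)‾_{λM,λa}(λz) = c • ((α ∘ D_λ)~ m_s ⊗ m_s)‾_{M,a}(z)` with the constant
`c = (λ²)^s (λ²)^{-max(s,0)} λ²` (inside the chart: the pointwise identity, junk values included;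
outside: both sides vanish, the chart domains being dilation covariant). [folklore] -/
private theorem extend_tensorise_rescale_dilate (hlam : 0 < lam) (M a r₀ : ℝ) (s : ℤ)
    (α : Kerr.region (lam * a) (lam * r₀) → ℂ) (z : E4) :
    Function.extend Subtype.val
        (Kerr.tensorise (lam * a) s (Kerr.rescale (lam * M) (lam * a) s α))
        (0 : E4 → Fin 4 → Fin 4 → ℂ) (lam • z) =
      ((lam ^ 2) ^ s * (lam ^ 2) ^ (-max s 0) * lam ^ 2 : ℝ) •
        Function.extend Subtype.val (Kerr.tensorise a s (Kerr.rescale M a s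
          (fun y : Kerr.region a r₀ ↦
            α ⟨lam • (y : E4), (Kerr.mem_region_dilate_iff hlam).2 y.2⟩)))
          (0 : E4 → Fin 4 → Fin 4 → ℂ) z := by
  set T' := Kerr.tensorise (lam * a) s (Kerr.rescale (lam * M) (lam * a) s α) with hT'
  set T := Kerr.tensorise a s (Kerr.rescale M a s (fun y : Kerr.region a r₀ ↦
    α ⟨lam • (y : E4), (Kerr.mem_region_dilate_iff hlam).2 y.2⟩)) with hT
  by_cases hz : z ∈ Kerr.region a r₀
  · have hz' : lam • z ∈ Kerr.region (lam * a) (lam * r₀) := (Kerr.mem_region_dilate_iff hlam).2 hz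
    have h1 : Function.extend Subtype.val T' (0 : E4 → Fin 4 → Fin 4 → ℂ) (lam • z) =
        T' ⟨lam • z, hz'⟩ := Subtype.val_injective.extend_apply _ _ ⟨lam • z, hz'⟩
    have h2 : Function.extend Subtype.val T (0 : E4 → Fin 4 → Fin 4 → ℂ) z = T ⟨z, hz⟩ :=
      Subtype.val_injective.extend_apply _ _ ⟨z, hz⟩
    rw [h1, h2, hT', hT]
    funext μ ν
    simp only [Kerr.tensorise, Kerr.rescale, Pi.smul_apply, Complex.real_smul,
      rescaleFactor_dilate hlam, spinFrame_dilate hlam]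
    push_cast
    ring
  · have hz' : lam • z ∉ Kerr.region (lam * a) (lam * r₀) :=
      fun h ↦ hz ((Kerr.mem_region_dilate_iff hlam).1 h)
    rw [Function.extend_apply' _ _ _ fun ⟨y, hy⟩ ↦ hz' (hy ▸ y.2),
      Function.extend_apply' _ _ _ fun ⟨y, hy⟩ ↦ hz (hy ▸ y.2)]
    simp

/-- **`D3` — the weighted energies are dilation comparable** (stub `stub_teukolskyEnergyOn_dilate`
of the line `bounded-kappa-closing-box` for the crux `BulkKerrCaptureC2`): for `λ` in a compact
range `[lo, hi] ⊂ (0, ∞)` the `k`-th order `(1 + ‖y‖)^p`-weighted energy of `α̃ m_s ⊗ m_s`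
through `{t* = λτ} ∩ {y ∈ λ • A}` on the chart `{r > λr₀}` of Kerr(`λM, λa`) and that of
`(α ∘ D_λ)~ m_s ⊗ m_s` through `{t* = τ} ∩ {y ∈ A}` on `{r > r₀}` of Kerr(`M, a`) bound each
other up to `K = D^{2N + 2k + 3} D^{|p|}`, `D = max 1 hi lo⁻¹`, `N = 4|s| + 2` (the tensorised
rescaled fields satisfy `T_dil(λz) = c T(z)` identically, so that
`‖D^j T_dil‾(λz)‖ ≤ |c| λ^{-j} ‖D^j T‾(z)‖` for every `α`; Lebesgue measure scales by `λ³`, the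
weights by at most `D^{|p|}`).
[cite: DafermosHolzegelRodnianskiTaylor2022, §1.1 (1.3)] -/
theorem stub_teukolskyEnergyOn_dilate :
    ∀ (s : ℤ) (k : ℕ) (p lo hi : ℝ) (hlo : 0 < lo), lo ≤ hi → ∃ K : ℝ, 0 < K ∧
      ∀ (lam : ℝ) (hlam : lo ≤ lam), lam ≤ hi →
        ∀ (M a r₀ : ℝ) (α : Kerr.region (lam * a) (lam * r₀) → ℂ) (τ : ℝ) (A : Set E3),
          Kerr.teukolskyEnergyOn (lam * M) (lam * a) (lam * r₀) s α (lam * τ) k p (lam • A) ≤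
              ENNReal.ofReal K * Kerr.teukolskyEnergyOn M a r₀ s
                (fun y : Kerr.region a r₀ ↦
                  α ⟨lam • (y : E4), (Kerr.mem_region_dilate_iff (hlo.trans_le hlam)).2 y.2⟩)
                τ k p A ∧
            Kerr.teukolskyEnergyOn M a r₀ s
                (fun y : Kerr.region a r₀ ↦
                  α ⟨lam • (y : E4), (Kerr.mem_region_dilate_iff (hlo.trans_le hlam)).2 y.2⟩)
                τ k p A ≤
              ENNReal.ofReal K *
                Kerr.teukolskyEnergyOn (lam * M) (lam * a) (lam * r₀) s α (lam * τ) k p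
                  (lam • A) := by
  intro s k p lo hi hlo _
  -- the constant: `D = max 1 (max hi lo⁻¹)` dominates `1`, `λ` and `λ⁻¹` on `[lo, hi]`
  obtain ⟨D, hD, hhiD, hloD⟩ : ∃ D : ℝ, 1 ≤ D ∧ hi ≤ D ∧ lo⁻¹ ≤ D :=
    ⟨max 1 (max hi lo⁻¹), le_max_left _ _, (le_max_left _ _).trans (le_max_right _ _),
      (le_max_right _ _).trans (le_max_right _ _)⟩
  have hD0 : 0 < D := one_pos.trans_le hD
  refine ⟨D ^ (2 * (4 * s.natAbs + 2) + 2 * k + 3) * D ^ |p|, by positivity, ?_⟩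
  intro lam hlam hlamhi M a r₀ α τ A
  have hlam0 : 0 < lam := hlo.trans_le hlam
  have hlamD : lam ≤ D := hlamhi.trans hhiD
  have hlamD' : lam⁻¹ ≤ D := (inv_anti₀ hlo hlam).trans hloD
  -- the scaling constant `c = (λ²)^s (λ²)^{-max(s,0)} λ²` and its inverse are at most `D^N`
  have hl2 : lam ^ 2 ≤ D ^ 2 := pow_le_pow_left₀ hlam0.le hlamD 2
  have hl2' : (lam ^ 2)⁻¹ ≤ D ^ 2 :=
    inv_pow lam 2 ▸ pow_le_pow_left₀ (inv_nonneg.2 hlam0.le) hlamD' 2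
  have hc0 : 0 < (lam ^ 2) ^ s * (lam ^ 2) ^ (-max s 0) * lam ^ 2 := by positivity
  have hcN : |(lam ^ 2) ^ s * (lam ^ 2) ^ (-max s 0) * lam ^ 2| ≤ D ^ (4 * s.natAbs + 2) := by
    rw [abs_of_pos hc0]
    exact scaleConst_le s (pow_pos hlam0 2) hD hl2 hl2'
  have hcN' : |((lam ^ 2) ^ s * (lam ^ 2) ^ (-max s 0) * lam ^ 2)⁻¹| ≤ D ^ (4 * s.natAbs + 2) := by
    rw [abs_of_pos (inv_pos.2 hc0), mul_inv, mul_inv, ← inv_zpow, ← inv_zpow]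
    exact scaleConst_le s (inv_pos.2 (pow_pos hlam0 2)) hD hl2' (by rwa [inv_inv])
  exact sliceSobolevEnergy_dilate_le_le k p hD hlam0 hlamD hlamD' hc0.ne' hcN hcN'
    (fun z ↦ Kerr.mem_region_dilate_iff hlam0) (extend_tensorise_rescale_dilate hlam0 M a r₀ s α)
    τ A

end Summit.FinalStateConjecture.FinalStateConjecture.Theorems.BulkKerrCaptureC2.TeukolskyEnergyDilate

end
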